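import Summits.AtomisticToContinuum.HydrodynamicLimit.Theses.InformationPercolationEngine
import Literature.MathematicalPhysics.KineticTheory.TaggedSphereDiffusionCorrector
import Literature.MeasureTheory.Lebesgue.SierpinskiSphereSet
import Summits.AtomisticToContinuum.HydrodynamicLimit.Theorems.SpectralContractionR.Negative.WithoutMeanZero
import Summits.AtomisticToContinuum.HydrodynamicLimit.Theorems.SpectralContractionR.Negative.WithoutMeasurable
import Summits.AtomisticToContinuum.HydrodynamicLimit.Theorems.SpectralContractionR.Negative.WithoutIntegrable

/-!
# Disproof of `SpectralContractionR` (stmt-AtomisticToContinuum-13913) — findings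

Standing adversary file of the cdisprove seat (refuter-cdisprove-stmt-AtomisticToContinuum-13913-0).
Crux (rev-3 repair of the refuted-misstated `SpectralContraction`, stmt-13479):
`∃ c < 1/2, ∀ f measurable with ∫ f² νM < ∞ and ∫ f νM = 0: ∫ (K f)² νM ≤ c ∫ f² νM`, where
`ν(v) = ∫∫ ((v-w)·ω)₊ M(w) dS dw`, `(K f)(v) = ν(v)⁻¹ ∫∫ ((v-w)·ω)₊ M(w) f(v - ((v-w)·ω)ω) dS dw`,
`M` the standard Maxwellian on `ℝ³`, i.e. `‖K|_{1^⊥}‖²_{L²(π)} < 1/2`, `π ∝ νM`.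

## VERDICT OF THIS CYCLE: NO KILL — the crux is TRUE, and provable with `c = 1/4`. (File sorry-free.)

WHY IT RESISTS (checked on paper symbol by symbol; numerics: j004803/j005123 of the ideators, the rattack seat's
Nyström on stmt-13479, and this seat's MC replication kit j013650 — see NUMERICS below):
1. No typing loophole is left. For measurable `f` with `∫ f² νM < ∞`: `f ∈ L²(π) ⊂ L¹(π)`; for EVERY `v`
   the honest double integral `∫_w ∫_ω B M(w) |f(v')|` is finite (Carleman form: kernel
   `k(v→v') = (2π)^{-1/2} |v'-v|⁻¹ exp(-(v'·(v'-v))²/(2|v'-v|²))`, and `∫ k(v→·)²/π < ∞` by reversibility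
   `k(v→v')π(v) = k(v'→v)π(v')` and `k ≤ (2π)^{-1/2}/|v-v'|`), so the inner `ω`-integral is Bochner-junk only
   on a `w`-null set and the typed `K f v` IS the honest gain average (tree: `linearBoltzmannGain_eq_carlemanGain`,
   `ae_integrable_carlemanKernel_mul`); values of `f` on Lebesgue-null sets are invisible to `K f v` for every `v`
   (the push-forward of `B M dS dw` under `(w, ω) ↦ v'` is `k(v→v') dv' ≪ Lebesgue`); outer junk in
   `∫ (K f)² νM` can only LOWER the left side to `0 ≤ c · RHS`. So the decl says exactly `λ₂(K)² < 1/2` on `L²(π)`.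
   DICTIONARY FOR PROVERS (machine-checked in `Negative/WithoutIntegrableWitness.lean`, proof of `K_f_eq`): the typed
   inner double integral IS `linearBoltzmannGain 1 f v` by `simp only [linearBoltzmannGain_eq, gainIntegrand,
   maxwellianBeta_one]`, `ν = TaggedSphereDiffusion.collisionFrequency 1` (`SpectralContractionRWithoutMeanZero.nu_eq`),
   and then `linearBoltzmannGain_eq_carlemanGain` (pointwise in `v`, given `Integrable (k₁(v,·) f(v+·))`, which
   `ae_integrable_carlemanKernel_mul` supplies for a.e. `v` from `∫ f² νM < ∞`) puts `K f` in Carleman form,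
   where `carlemanForm`, `carlemanForm_comm` (reversibility) and `sq_carlemanForm_le` (Cauchy–Schwarz) live.
2. `K = K₂/2`: the crux's gain operator is EXACTLY ONE HALF of the gain part `K₂ f = ∫∫ B M(w) [f(v') + f(w')]`
   of the lineariZED hard-sphere Boltzmann operator (the `f(w')` piece has the same Carleman kernel as the `f(v')`
   piece — computed here: both equal `(2π)^{-1/2}|p|⁻¹ exp(-(v'·p̂)²/2)`, `p = v' - v`). Hence the H-theorem
   `⟨L f, f⟩_M = -¼ ∫∫∫ B M M [f(v')+f(w')-f(v)-f(w)]² ≤ 0`, `L = K₂ - K₁ - ν`, is the IDENTITY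
   `⟨K f, f⟩_π = ½‖f‖²_π + ½ E_Λ[f(v) f(w)] - ⅛ E[(f(v')+f(w')-f(v)-f(w))²]`   (Λ ∝ |v-w| M M the flux pair law)
   — the idea cards' "swap-symmetrisation"/"antipodal Jensen" bound `K ≼ ½(I + W)` with the dissipation made
   explicit (kit j013650 confirms the identity to MC accuracy on 14 test functions, NUMERICS below).
3. `E_Λ[f(v) f(w)] ≤ -(E_M f)² ≤ 0` for every π-centred `f`: Schoenberg (|x-y| is of negative type on ℝ³) on the
   hyperplane `∫ h = 0`, TRANSPORTED to the π-centred hyperplane by `bilin_nonpos_of_orthogonal` below (the crux's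
   mean-zero hypothesis `∫ f νM = 0` is `Q(fM, M) = 0` for `Q(h,h') = ∫∫|x-y| h h'`, because `ν = π ∫|·-w| M(w) dw`).
   So `0 ≤ ⟨K f, f⟩_π ≤ ½‖f‖²_π` on `1^⊥` (`K ≽ 0`: `v, v'` are conditionally i.i.d. given `(v+w, |v-w|)` — 3-D
   hard-sphere CM scattering is isotropic), and ONE Cauchy–Schwarz for the PSD form `(f,g) ↦ ⟨Kf,g⟩_π`
   (`sq_le_quarter_of_psd_halfBound` below) gives `∫ (Kf)² dπ ≤ ¼ ∫ f² dπ`: the crux with `c = 1/4`.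
   Numerically `λ₂ = 0.468 ± 0.001 < ½`; EXACT LOWER BOUND `λ₂ ≥ 7/15 = 0.4667` (energy mode `|v|²−7/2`, by PSD); STRICT
   `λ₂ < ½` qualitatively (`dissipation_eq_zero_of_form_eq_half`: equality forces a summational invariant, for which the
   partner term is strictly negative; attainment by compactness of `K`).
NUMERICS (this seat, kit j013650: exact stationary sampler of the flux pair law, N = 2·10⁶ pairs, two conditionally
independent collisions per `v` for `‖Kf‖²`, 22 s): (i) the IDENTITY of item 2 holds to MC accuracy on all 14 test functions
(|⟨Kf,f⟩ − (½‖f‖² + ½W − D/8)|/‖f‖² ≤ 0.004, each within 2σ), with the exact values reproduced: `⟨Kf,f⟩/‖f‖² = 0.4283`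
(3/7 = 0.4286) for `v_x`, `0.4661` (7/15 = 0.4667) for `|v|²−7/2`; `W/‖f‖² = −0.1438` (−1/7) and `−0.0664` (−1/15);
(ii) NEGATIVE TYPE `W ≤ −(E_M f)²` true on all 14; (iii) cross-fitted Galerkin pencils (13 Gaussian energy bumps × sectors
ℓ = 0..3): top `⟨Kf,f⟩/‖f‖²` = 0.4674 (ℓ=0), 0.4316 (ℓ=1), 0.197 (ℓ=2), 0.098 (ℓ=3), all sector bottoms in [+0.008, +0.012]
(PSD), top `‖Kf‖²/‖f‖²` = 0.220 (ℓ=0), 0.186 (ℓ=1), 0.040, 0.010 — i.e. `λ₂ ≈ 0.468`, `λ₂² ≈ 0.22 < 1/2`, in agreement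
with the rattack Nyström (0.4685/0.4332/0.205/0.114) and the ideators' j004803/j005123. The ℓ=0 top sits only 0.001 above the
exact energy-mode quotient 7/15: the top eigenfunction is essentially the energy mode.
Consequently NO counterexample search can succeed; this file records the LOAD-BEARING hypotheses instead.

## Index
* (a) `spectralContractionR_false_without_meanZero` — drop `∫ f νM = 0`: `f ≡ 1` gives `Z ≤ cZ`. LANDED
      (`Theorems/SpectralContractionR/Negative/WithoutMeanZero.lean`, p70078).
* (a) `spectralContractionR_false_without_measurable` — drop `Measurable f`: this IS the refuted rev-2 decl; the
      Sierpiński-sphere-set witness (re-hosted here verbatim from the landed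
      `Theorems/InformationPercolationEngineSpectralContractionRefutation.lean`, whose target decl no longer exists in
      the rev-3 route file). LANDED (`Theorems/SpectralContractionR/Negative/WithoutMeasurable.lean`, p70343).
      Any proof must use measurability (it does: Fubini/Carleman in step 1).
* (a) `spectralContractionR_false_without_integrable` — drop `Integrable (f² νM)`: FALSE, witness the radial
      spike sum `g − mean`, `g = Σ 2^{7(n+1)} 1_{|v|<2^{-4(n+1)}} ∈ L¹(π) \ L²(π)` (RHS = Bochner junk `c·0`, typed
      `K f` honest via the Carleman representation with `k₁ ≤ (2π)^{-1/2}|u|⁻¹`, bounded, `≤ −m/2` far out ⇒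
      LHS > 0). LANDED in three files (`Negative/WithoutIntegrableSpikes|Witness|WithoutIntegrable.lean`). With
      the two items above, the load-bearing analysis of ALL THREE hypotheses on `f` is complete and SORRY-FREE.
* (a) dropping `c < 1/2`: trivially TRUE with `c = 1` (`K` is an `L²(π)`-contraction) — not load-bearing
      for truth, only for the route (Kesten–Stigum side).
* (b) `bilin_nonpos_of_orthogonal`, `sq_le_quarter_of_psd_halfBound`, `form_le_half_of_dissipation` — the three
      algebraic pivots of the proof line, abstract and SORRY-FREE (why no witness can exist).
* (c) natural strengthenings: `SpectralContractionRFifth` (`c ≤ 1/5`) is FALSE numerically and by the exact energy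
      mode (`⟨Kf,f⟩/‖f‖² = 7/15` for `f = |v|² - 7/2`, so `‖Kf‖²/‖f‖² ≥ (7/15)² = 49/225 > 1/5` by PSD) — recorded,
      not formalised (exact flux-Gaussian moments); `c ≤ 1/4` is OPEN-TIGHT: true numerically (0.219), and exactly
      what the analytic line proves.
* ROUTE-LEVEL CAVEAT (not a refutation of this decl; for the planner / crux PercolationClosesChaos):
      PolyanskiyWu2017 Thm 5 (arXiv:1508.06025 §3 p. 7) percolates with the per-VERTEX constant
      `η_v = η_KL(P_{Y_v | Y_pa(v)})` of the channel from ALL parents jointly, input-independent. For the collision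
      vertex `(v, w) ↦ v' = (v+w)/2 + |v-w| n/2` that constant is `1` (noiseless on the diagonal `v = w`), so Thm 5
      as printed is void here; the input-dependent χ² constant of the JOINT channel under Λ is
      `sup Var(E[g(v')|v,w])/Var g = sup ⟨Kg,g⟩/‖g‖² = λ₂(K) = 0.468` (NOT `λ₂² = 0.219`), so "branching 2" sits at
      `2·0.468 = 0.936 < 1` with margin 0.06, and the analytic line certifies only `λ₂ ≤ ½` = CRITICAL. The quantity
      this crux certifies, `λ₂² = η_χ²` of the single-parent channel (partner refreshed from the bath), is the
      Kesten–Stigum/census constant; below-KS non-reconstruction is channel-specific (EvansEtAl2000 for BSC only).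
-/

noncomputable section

open MeasureTheory Metric Real Set Filter Topology
open scoped InnerProductSpace ENNReal Pointwise

namespace Summit.AtomisticToContinuum.HydrodynamicLimit.Cruxes.SpectralContractionR.Disproof

open Literature.MathematicalPhysics.KineticTheory
open Literature.Analysis.FunctionSpaces (maxwellianBeta maxwellianBeta_one maxwellianBeta_pos)
open Literature.Analysis.FluidPDE (globalMaxwellian globalMaxwellian_pos)
open Summit.AtomisticToContinuum.HydrodynamicLimit.Theses.InformationPercolationEngine (SpectralContractionR)

/-! ## §1 (a) Load-bearing hypotheses — LANDED under `Theorems/SpectralContractionR/Negative/`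

The defs `SpectralContractionRWithoutMeanZero`, `SpectralContractionRWithoutMeasurable` (the crux verbatim with one
hypothesis deleted) and their refutations now live in the tree (p70078 @7e802a4a2052, p70343); this workfile only
re-exports them under the crux namespace so that ideators / planners find them from `disproof_path`. -/

/-- ANY PROOF MUST USE MEAN-ZERO (landed, p70078): without `∫ f νM = 0`, `f ≡ 1` gives `Z ≤ cZ`. [folklore] -/
theorem spectralContractionR_false_without_meanZero :
    ¬ Summit.AtomisticToContinuum.HydrodynamicLimit.Theorems.SpectralContractionRWithoutMeanZero :=
  Summit.AtomisticToContinuum.HydrodynamicLimit.Theorems.spectralContractionR_false_without_meanZero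

/-- ANY PROOF MUST USE MEASURABILITY (landed, p70343): without `Measurable f` the decl is the retired rev-2
`SpectralContraction`, killed by the Sierpiński-sphere-set ±1 witness (Bochner-junk mean, `K f ≡ 1`). [folklore] -/
theorem spectralContractionR_false_without_measurable :
    ¬ Summit.AtomisticToContinuum.HydrodynamicLimit.Theorems.SpectralContractionRWithoutMeasurable :=
  Summit.AtomisticToContinuum.HydrodynamicLimit.Theorems.spectralContractionR_false_without_measurable

/-- The rev-3 repair is minimal: rev-2 decl + `Measurable f →` (landed as `.imp`). [folklore] -/
theorem spectralContractionR_of_withoutMeasurable :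
    Summit.AtomisticToContinuum.HydrodynamicLimit.Theorems.SpectralContractionRWithoutMeasurable →
      SpectralContractionR :=
  Summit.AtomisticToContinuum.HydrodynamicLimit.Theorems.SpectralContractionRWithoutMeasurable.imp

/-- Mean-zero is the ONLY thing separating the crux from its hypothesis-free shell: the crux implies the
`WithoutMeanZero` shape restricted to mean-zero `f` (bookkeeping; shows the two defs differ by exactly that
binder). [folklore] -/
theorem withoutMeanZero_shape_of_spectralContractionR (h : SpectralContractionR) :
    ∃ c : ℝ, c < 1 / 2 ∧ ∀ f : V3 → ℝ, Measurable f →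
      Integrable (fun v => f v ^ 2 *
        ((∫ w, ∫ ω, hardSphereKernel (v, w) ω * globalMaxwellian w ∂sphereMeasure) * globalMaxwellian v)) →
      ∫ v, f v * ((∫ w, ∫ ω, hardSphereKernel (v, w) ω * globalMaxwellian w ∂sphereMeasure) *
        globalMaxwellian v) = 0 →
      ∫ v, ((∫ w, ∫ ω, hardSphereKernel (v, w) ω * globalMaxwellian w ∂sphereMeasure)⁻¹ *
          ∫ w, ∫ ω, hardSphereKernel (v, w) ω * globalMaxwellian w *
            f (collide ω (v, w)).1 ∂sphereMeasure) ^ 2 *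
        ((∫ w, ∫ ω, hardSphereKernel (v, w) ω * globalMaxwellian w ∂sphereMeasure) * globalMaxwellian v) ≤
      c * ∫ v, f v ^ 2 *
        ((∫ w, ∫ ω, hardSphereKernel (v, w) ω * globalMaxwellian w ∂sphereMeasure) * globalMaxwellian v) := by
  obtain ⟨c, hc, h⟩ := h
  exact ⟨c, hc, fun f hf hint hmean => h f hf hint hmean⟩

/-- ANY PROOF MUST USE INTEGRABILITY (landed: `Negative/WithoutIntegrableSpikes`, `…Witness`, `…WithoutIntegrable`):
without `Integrable (f² νM)` the radial spike sum `f = g - m`, `g = Σ_n 2^{7(n+1)} 1_{|v| < 2^{-4(n+1)}}`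
(`g ∈ L¹(νM) \ L²(νM)`, honest mean zero) makes the right side Bochner junk `c · 0` while the typed `K f` is the
HONEST bounded Carleman average `ν⁻¹ ∫ k₁ g - m ≤ -m/2` far out, so the left side is `> 0`. [folklore] -/
theorem spectralContractionR_false_without_integrable :
    ¬ Summit.AtomisticToContinuum.HydrodynamicLimit.Theorems.SpectralContractionRWithoutIntegrable :=
  Summit.AtomisticToContinuum.HydrodynamicLimit.Theorems.spectralContractionR_false_without_integrable

/-! ## §2 (b) Why no witness can exist: the three algebraic pivots of the proof line (abstract, sorry-free) -/

/-- PIVOT 1 (H-theorem ⇒ swap-symmetrisation bound). If the gain form satisfies the dissipation identity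
`k = n/2 + W/2 - D/8` with `D ≥ 0` (it does: `D = E[(f(v')+f(w')-f(v)-f(w))²]`, because `K = K₂/2`) and the
partner correlation `W = E_Λ[f(v)f(w)] ≤ 0`, then `k ≤ n/2`. [folklore] -/
theorem form_le_half_of_dissipation {k n W D : ℝ} (hk : k = n / 2 + W / 2 - D / 8) (hD : 0 ≤ D)
    (hW : W ≤ 0) : k ≤ n / 2 := by
  rw [hk]; linarith

/-- EQUALITY CASE of pivot 1 (why `λ₂ < ½` is STRICT, qualitatively): `k = n/2` forces `D = 0` AND `W = 0`.
`D = 0` says `f(v′)+f(w′) = f(v)+f(w)` a.e. on the collision manifold, i.e. `f` is a (measurable) summational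
invariant `a + b·v + c|v|²`; mean-zero leaves `b·v + c(|v|² − 7/2)`, for which `W = E_Λ[f(v)f(w)] = −|b|²/6 − c²/2 < 0`
unless `f = 0` (`E_Λ[v_x w_x] = −1/6`, `E_Λ[(|v|²−7/2)(|w|²−7/2)] = 7/2 − 4 = −1/2`, cross terms odd). With `K` compact on
`L²(π)` (tree: `TaggedSphereGainCompact`, `gainOp`) the top of `spec K|_{1^⊥}` is an attained eigenvalue, hence
`λ₂ < ½` strictly — no explicit margin, but enough for `Σ_M (2λ₂)^M < ∞` in the joint-channel currency of the
route-level caveat. Numerically `7/15 = 0.4667 ≤ λ₂ = 0.468 < ½` (lower bound: the energy mode). [folklore] -/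
theorem dissipation_eq_zero_of_form_eq_half {k n W D : ℝ} (hk : k = n / 2 + W / 2 - D / 8) (hD : 0 ≤ D)
    (hW : W ≤ 0) (heq : k = n / 2) : D = 0 ∧ W = 0 := by
  rw [heq] at hk
  constructor <;> linarith

/-- PIVOT 2 (Schoenberg transported to the π-centred hyperplane). A symmetric bilinear form `Q` that is `≤ 0`
on a hyperplane `ker ℓ` and `≥ 0` at one point `M` with `ℓ M = 1` is `≤ 0` on the `Q`-orthogonal complement of
`M`. Used with `Q(h,h') = ∫∫ |x-y| h(x) h'(y)`, `ℓ h = ∫ h`, `M` the Maxwellian: the crux's hypothesis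
`∫ f νM = 0` is `Q(fM, M) = 0` (`ν ∝ ∫|·-w|M(w)dw`), NOT `∫ fM = 0` — this lemma is the bridge. [folklore] -/
theorem bilin_nonpos_of_orthogonal {V : Type*} [AddCommGroup V] [Module ℝ V]
    (Q : V →ₗ[ℝ] V →ₗ[ℝ] ℝ) (hQ : ∀ x y, Q x y = Q y x) (ℓ : V →ₗ[ℝ] ℝ) (M : V) (hM : ℓ M = 1)
    (hneg : ∀ x, ℓ x = 0 → Q x x ≤ 0) (hMM : 0 ≤ Q M M) (h : V) (hh : Q h M = 0) : Q h h ≤ 0 := by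
  set a : ℝ := ℓ h with ha
  have h0 : ℓ (h - a • M) = 0 := by simp [hM, ha]
  have hq0 := hneg _ h0
  have e1 : Q (h - a • M) (h - a • M) = Q h h - 2 * a * Q h M + a ^ 2 * Q M M := by
    simp only [map_sub, map_smul, LinearMap.sub_apply, LinearMap.smul_apply, smul_eq_mul, hQ M h]
    ring
  rw [hh] at e1
  nlinarith [hq0, mul_nonneg (sq_nonneg a) hMM]

/-- PIVOT 3 (one Cauchy–Schwarz, no spectral theorem). For a symmetric positive-semidefinite form
`Q(f,g) = ⟨K f, g⟩` over an inner form `N`, with `K` leaving a subspace `S` invariant on which `Q ≤ N/2`: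
`‖K f‖² ≤ ¼ ‖f‖²` on `S`. With `S = 1^⊥ ⊂ L²(π)` this is the crux with `c = 1/4`. [folklore] -/
theorem sq_le_quarter_of_psd_halfBound {V : Type*} [AddCommGroup V] [Module ℝ V]
    (Q N : V →ₗ[ℝ] V →ₗ[ℝ] ℝ) (K : V →ₗ[ℝ] V) (hQK : ∀ f g, Q f g = N (K f) g)
    (hQ : ∀ f g, Q f g = Q g f) (hpsd : ∀ f, 0 ≤ Q f f) (hN : ∀ f, 0 ≤ N f f)
    (S : Submodule ℝ V) (hS : ∀ f ∈ S, K f ∈ S) (hhalf : ∀ f ∈ S, Q f f ≤ N f f / 2)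
    (f : V) (hf : f ∈ S) : N (K f) (K f) ≤ N f f / 4 := by
  -- Cauchy–Schwarz for the PSD symmetric form `Q`: `(Q f g)² ≤ Q f f * Q g g`
  have cs : ∀ x y : V, Q x y ^ 2 ≤ Q x x * Q y y := by
    intro x y
    have hquad : ∀ t : ℝ, 0 ≤ Q y y * (t * t) + (-(2 * Q x y)) * t + Q x x := by
      intro t
      have := hpsd (x - t • y)
      have e : Q (x - t • y) (x - t • y) = Q y y * (t * t) + (-(2 * Q x y)) * t + Q x x := by
        simp only [map_sub, map_smul, LinearMap.sub_apply, LinearMap.smul_apply, smul_eq_mul, hQ y x]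
        ring
      linarith [e ▸ this]
    have hd := discrim_le_zero hquad
    rw [discrim] at hd
    nlinarith [hd]
  have h1 : N (K f) (K f) = Q f (K f) := (hQK f (K f)).symm
  have h2 := cs f (K f)
  have h3 := hhalf f hf
  have h4 := hhalf (K f) (hS f hf)
  have hx : 0 ≤ N (K f) (K f) := hN _
  have hn : 0 ≤ N f f := hN _
  rw [← h1] at h2
  -- x² ≤ (n/2) (x/2)
  have h5 : N (K f) (K f) ^ 2 ≤ N f f / 2 * (N (K f) (K f) / 2) := by
    calc N (K f) (K f) ^ 2 ≤ Q f f * Q (K f) (K f) := h2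
      _ ≤ N f f / 2 * (N (K f) (K f) / 2) :=
        mul_le_mul h3 h4 (hpsd _) (by linarith)
  nlinarith [h5, hx, hn]

/-! ## §3 (c) Natural strengthenings (records; see the module docstring) -/

/-- STRENGTHENING `c ≤ 1/5` (the crux with `c < 1/2` replaced by `c ≤ 1/5`). FALSE: by positivity of `K`,
`‖Kf‖²/‖f‖² ≥ (⟨Kf,f⟩/‖f‖²)² = (7/15)² = 49/225 > 1/5` for the energy mode `f = |v|² - 7/2` (exact flux-Gaussian
moments: `E_π|v|² = 7/2`, `⟨Kf,f⟩_π = Var((|P|²+|q|²)/4) = 7/2`, `‖f‖²_π = 15/2` in `P = v+w ∼ N(0,2I)`,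
`|q|²/4 ∼ Γ(2)`), and numerically `λ₂² = 0.219`. Not formalised (needs those moments in Lean). The constant
`1/4` is what the analytic line proves and is numerically true with margin 0.03 in `λ₂`. -/
def SpectralContractionRFifth : Prop :=
  ∃ c : ℝ, c ≤ 1 / 5 ∧ let M : Literature.MathematicalPhysics.KineticTheory.V3 → ℝ := Literature.Analysis.FluidPDE.globalMaxwellian; let S : MeasureTheory.Measure (Metric.sphere (0 : Literature.MathematicalPhysics.KineticTheory.V3) 1) := Literature.MathematicalPhysics.KineticTheory.sphereMeasure; let ν : Literature.MathematicalPhysics.KineticTheory.V3 → ℝ := fun v => ∫ w, ∫ ω, Literature.MathematicalPhysics.KineticTheory.hardSphereKernel (v, w) ω * M w ∂S; let K : (Literature.MathematicalPhysics.KineticTheory.V3 → ℝ) → Literature.MathematicalPhysics.KineticTheory.V3 → ℝ := fun f v => (ν v)⁻¹ * ∫ w, ∫ ω, Literature.MathematicalPhysics.KineticTheory.hardSphereKernel (v, w) ω * M w * f (Literature.MathematicalPhysics.KineticTheory.collide ω (v, w)).1 ∂S; ∀ f : Literature.MathematicalPhysics.KineticTheory.V3 → ℝ, Measurable f → MeasureTheory.Integrable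 (fun v => f v ^ 2 * (ν v * M v)) → ∫ v, f v * (ν v * M v) = 0 → ∫ v, K f v ^ 2 * (ν v * M v) ≤ c * ∫ v, f v ^ 2 * (ν v * M v)

/-- The strengthening implies the crux (so refuting the crux would refute it; the converse kill
`¬ SpectralContractionRFifth` is the open tightness record above). [folklore] -/
theorem spectralContractionR_of_fifth : SpectralContractionRFifth → SpectralContractionR := by
  rintro ⟨c, hc, h⟩
  exact ⟨c, by linarith, h⟩

-- Targets: none yet (payload.targets = [], no skeleton registered for this crux at cycle 1).

end Summit.AtomisticToContinuum.HydrodynamicLimit.Cruxes.SpectralContractionR.Disproof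

end
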